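import Summits.CriticalPhenomena.PercolationContinuityZ3.Theorems.Transplant.SkelPhiFaceHoldsKits9VC
import Summits.CriticalPhenomena.PercolationContinuityZ3.Theorems.Transplant.SkelPhiFaceKitsOfNums9VCQ
import Summits.CriticalPhenomena.PercolationContinuityZ3.Theorems.Transplant.SkelPhiFaceRunNb2VQ
import HarnessLib

/-!
# WAVE-Q binder row «SkelPhiFaceHoldsKits9VC» ↦ «SkelPhiFaceHoldsKits9VCQ» (quasi-step rung (N3-b); captain gen-1 g4, WAVE-Q-BINDER-rows v0.7/v0.8, row Q60, FLOOR row; family stmt-g33 = «SkelPhiCorridor*» / «SkelPhiFace*»):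
# **`FaceOblRMOF` OF THE FINE-CELL SCHEME OF RECORD FROM THE KIT INPUTS AND THE PER-CENTRE NUMBERS, UNDER EXACT-FOOTPRINT QUASI-STEPS** — `Skelφ.faceOblRM_of_kits9VCQ`

builds on p205010 (kernel theorem, internal audit signed; external expert review pending) — nothing in this file uses p205010; nothing here is a claim about any open node (the quasi-step node's statement, name and
wording are a lead's).  Lane `prim-bschramm`, seat `prim-bschramm-stmt` gen 33 (port pen).  Helper file (`--supports stmt-CriticalPhenomena-4575 --as helper`); def-free.  PORT RULES (captain #6109/#6122 hunk
classes + R-1 = L-hp8-1 (b)): twin of the one `hstep`-threading declaration of the tree module «SkelPhiFaceHoldsKits9VC» (sha256 105e3248776174f6…, imported), statement and proof BYTE-IDENTICAL except: (i) `(hstep : Steps G φ) ↦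
{Mq : ℕ} (hqφ : Skelφ.QStepsN G φ Mq)` (named `Mq`: the window half-width is `M`), with the frame-cost floors `hPNb : 1 ≤ Pb.N ↦ Mq ≤ Pb.N`, `hPNr : kq + 3 ≤ Pr.N ↦ Mq·(kq+3) ≤ Pr.N`, `hPN : 3 ≤ PA.N ↦ 3·Mq ≤ PA.N`;
(ii) twins `faceOblRM_fineNb2V ↦ faceOblRM_fineNb2VQ` (Q49 p515209, this seat), `hkits_faceSteps_of_nums9VC ↦ …Q` (Q59, this seat); (iv) FLOOR tokens (p5-g28's pull list): the OFFSET floor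
`hoffN : ‖rep₂(cenS x)‖₁ + 1 ≤ off x ↦ Mq·‖rep₂(cenS x)‖₁ + 1 ≤ off x` (Q49), `hπ1 ↦ Mq·‖B.core1Lo‖₁ ≤ r`; kit floors `KCmaxb ↦ Pb.N·KCmaxb`, `KCmaxr ↦ Pr.N·KCmaxr`, `KCmax ↦ PA.N·KCmax` in `hDw·` (all six
run-window families), `hT'·`, `hr₀·`, `hrs·`, `hE·`, `hreach·`, `hMD`, and `KCmax· + 1 ↦ (KCmax·+1)·(P·.N+2)` in `hcS·`; and — LOCATED DESIGN ITEM L-stmt-1, OPTION (C) (bus 2026-08-27T09:24:31Z; refuter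
read p5-g28 09:25:46Z) — the THREE FLOOR FAMILIES `hπMx / hπMy / hπMyx` of «SkelPhiFaceKitsOfNums9VCQ» (run-length floors at quasi-step cost `Mq` over the numbers binders' `RcL/RcT/Nr/N₃`), threaded
verbatim.  No landed file is edited or re-issued.  Regression: `Mq = 1`, `P·.N`-tokens at `qStepsN_of_steps`, the three families from the records' fields give the original.  Docstrings and citations are the
original's.
-/

noncomputable section

open MeasureTheory ProbabilityTheory
open scoped ENNReal Classical

namespace Summit.CriticalPhenomena.PercolationContinuityZ3.Theorems.Transplant

namespace Skelφ

open Literature.Probability.Percolation Literature.Probability.LatticeModels SimpleGraph GadgetSystem Contour KNCells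
open Literature.Probability.Percolation.KozmaNitzan
open Literature.Probability.Percolation.KozmaNitzan.Cells (oth oth_ne sgOf sgOf_sign stepVec_apply_fst eq_oth_of_ne oth_oth)
open KNLevels ChainPlanar ChainPara
open Literature.Barriers.CriticalPhenomena (graphBall mem_graphBall_self graphBall_mono)
open BoxProdZ2 (ConcRadiiG Erad Frad nQ nS Realised Frad_succ Frad_le_Erad)
open Skel (winGraph routeW excess WinStepData)
open SkelI (tanOff)
open TwoAxis.Para (modulus detD rep₂)

variable {V : Type} [DecidableEq V] [Countable V] {G : SimpleGraph V} [G.LocallyFinite] {φ : V → Site 2}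

/-- (WAVE-Q twin of `faceOblRM_of_kits9VC` under `QStepsN G φ Mq`, L-stmt-1 option (C): three floor families `hπMx/hπMy/hπMyx` beside the numbers binders; `hoffN`, `hπ1` ×`Mq`; kit floors ×`P·.N` per the header.) **`FaceOblRMO` of the fine-cell scheme of record from the kit inputs and the per-centre numbers** (keystone v6 ∘ `faceOblRM_fineNb2V`;
see the module docstring). [cite: KozmaNitzan2024, §4 Lemma 10 (pp. 17–21), Lemma 12 (pp. 23–25), p. 30] -/
theorem faceOblRM_of_kits9VCQ (pr : FinePrm) (φ : V → Site 2) (P : PCells2V) (w₀ : V) (gap gap' : ℕ → ℕ) (E₀ L' : ℕ) (off : Site 2 → ℕ)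
    (b₀ : Fin 2 → ℕ) (q : unitInterval) (δc : ℝ)
    -- the binders of `faceOblRM_fineNb2V` (schemeO side)
    (hlip : Lip G φ) {Mq : ℕ} (hqφ : QStepsN G φ Mq) (hb₀ : ∀ i, b₀ i ≤ 3 * P.r i) (hb1 : ∀ i, 1 ≤ b₀ i) (hc₀ : 0 < pr.c₀)
    (hc₁ : 0 < pr.c₁)
    (hDd : pr.D = detD pr.A pr.n pr.h pr.vα pr.vβ) (hD : 0 < pr.D) (hL0 : pr.c₀ * pr.L 0 + 2 ≤ pr.D) (hL1 : pr.c₁ * pr.L 1 + 2 ≤ pr.D)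
    (hgap : ∀ n, 1 ≤ gap n) (hgap20 : ∀ n, 20 * P.rmax ≤ gap n) {c : ℕ} (hgapc : ∀ n, c ≤ gap n) (hE₀ : 2 ≤ E₀) (hL' : 1 ≤ L')
    (hoff : ∀ x : Site 2, off x ≤ c * ((x 0).natAbs + (x 1).natAbs) + 1)
    (hoffN : ∀ x : Site 2, Mq * ((rep₂ pr.A pr.n pr.h pr.vα pr.vβ pr.c₀ pr.c₁ (P.cenS x) 0).natAbs +
      (rep₂ pr.A pr.n pr.h pr.vα pr.vβ pr.c₀ pr.c₁ (P.cenS x) 1).natAbs) + 1 ≤ off x)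
    {Δ' : ℕ} (Rlev N M : ℕ) {δ₂ : ℝ} (hRlev : ∀ i, Rlev + 4 ≤ 10 * P.s i) (hRlev' : ∀ du : MDir, (Rlev : ℤ) + 5 + P.c du.1 ≤ 3 * P.r (oth du.1))
    (aw : MDir → ℕ) {k₀ : ℤ} {kF : Fin 2 → ℤ} (hk₀ : ∀ I, pr.rdN I (pr.bOf I) ≤ pr.rdK I (pr.bOf I) * k₀)
    (hk₀' : ∀ i, 3 * (P.r i : ℤ) + k₀ + 3 ≤ 5 * P.r i)
    (hroomF : ∀ du : MDir,
      pr.Mabs * (aw du + Rlev + 1) + pr.rdN du.1 (pr.bOf du.1) * (Rlev + 2) * pr.D ≤ pr.rdK du.1 (pr.bOf du.1) * kF du.1 * pr.D)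
    (hkF : ∀ I, kF I + 3 + P.c I + P.r (oth I) ≤ 5 * (P.r (oth I) : ℤ))
    (haw : ∀ du : MDir, (pr.rdK 1 (pr.bOf du.1) * (P.faceExt du 0 + 1) + pr.rdK 0 (pr.bOf du.1) * (P.faceExt du 1 + 1)) * pr.D ≤
      pr.Mabs * (aw du + 1))
    (hcount : 1 / (1 - (q : ℝ)) ^ (Δ' * N) ≤ δ₂ * ((Finset.Icc (M + 1) Rlev).card : ℝ))
    {η : ℝ} (hη : η ≤ δc / 2) (R₁ : ℕ → ℕ) {m : ℕ}
    (hR₁ : ∀ ρ R', R₁ ρ ≤ R' → ∀ (Rw : ℕ) (D' A' : Finset V), (∀ d ∈ D', d ∈ graphBall G w₀ Rw) →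
      (∀ d ∈ D', ∀ d' ∈ D', φ d - φ d' ∈ box 2 m) → A' ⊆ D' → (∀ a ∈ A', a ∈ graphBall G w₀ (ρ + 1)) →
        (bondPercolation G q).real (excess G w₀ R' D' A') ≤ η)
    (hdiam : ∀ b' : Fin 2, (pr.rdK 1 b' + pr.rdK 0 b') * ((50 * P.rmax : ℕ) + 1) * pr.D ≤ pr.Mabs * (m + 1))
    (hgapR : ∀ ρ, c + 2 * L' + R₁ ρ + 2 ≤ gap ρ)
    -- the binders of the keystone `hkits_faceSteps_of_nums6` (kit / route / Λ / numbers)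

    {Δg : ℕ} (hΔg : ∀ v, G.degree v ≤ Δg)
    (hA0 : 0 < pr.A) {nL : ℕ} (hnL : 1 ≤ nL) (hvL : |pr.vα| ≤ nL)
    (hmf : 0 ≤ modulus nL pr.h pr.vα pr.vβ)
    {nFc : Fin 2 → ℕ} (hnC : ∀ I, (nFc I : ℤ) ≤ pr.cOf I * |pr.A| * |pr.lvGen I (pr.bOf I)|)
    (hU3 : ∀ I, pr.D ≤ 3 * (nFc I : ℤ)) {E r : ℕ} (hδ₂ : 0 < δ₂)
    -- THE ROUTE BLOCK (c-uniform; all signs)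
    (B : BridgePrm) (hB : BridgeOK B)
    {kq : ℕ} (hκL : pr.h.natAbs ≤ kq * nL) (ℓ' R's qB Rl R'₃ qB₃ qB' qB₃' : ℕ)
    (hlay : (nL + pr.h.natAbs : ℕ) ≤ (nL : ℤ) * ℓ' + 1)
    (Rlev₁ N₁ j₀₁ j₁₁ Rlev₂ N₂ j₀₂ j₁₂ Rlev₃ N₃' j₀₃ j₁₃ : ℕ) (hRl₁ : Rlev₁ + 1 ≤ B.R') (hRl₂ : Rlev₂ + 1 ≤ R's) (hRl₃ : Rlev₃ + 1 ≤ R'₃)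
    (hj₁ : j₁₁ ≤ Rlev₁) (hj₂ : j₁₂ ≤ Rlev₂) (hj₃ : j₁₃ ≤ Rlev₃)
    (hB0 : Finset.Icc (pt nL (1 * pr.h)) (pt nL (1 * pr.h + ℓ')) ⊆ Finset.Icc B.B₀lo B.B₀hi) (hRlr : Rl ≤ r)
    -- the near-`c` block READ BY THE TWO LATTICE FUNCTIONALS (L-F2): bridge regions (every frame sign), hop prism, zone box, fine extents `kA`
    {Λ₀ Λ₁ : ℤ} {kA : Fin 2 → ℤ}
    (hΛR : ∀ x ∈ Finset.Icc B.regionLo B.regionHi, |pr.vβ * (1 * x 0) - pr.vα * x 1| ≤ Λ₀ ∧ |(nL : ℤ) * x 1 - pr.h * (1 * x 0)| ≤ Λ₁)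
    (hΛQ0 : modulus nL pr.h pr.vα pr.vβ + (nL : ℤ) * ((3 * ℓ' : ℕ) : ℤ) ≤ Λ₀) (hΛQ1 : (nL : ℤ) * ((3 * ℓ' : ℕ) : ℤ) ≤ Λ₁) {Mz : ℕ}
    (hΛZ : (|pr.vβ| + |pr.vα|) * (Mz : ℤ) ≤ Λ₀ ∧ ((nL : ℤ) + |pr.h|) * (Mz : ℤ) ≤ Λ₁)
    (hkA0 : pr.c₀ * (|pr.A| * Λ₀) ≤ kA 0 * pr.D) (hkA1 : pr.c₁ * (|pr.A| * Λ₁) ≤ kA 1 * pr.D)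
    {kb : ℕ} (hkbMz : (Mz : ℤ) ≤ kb) (hπ1 : Mq * ((B.core1Lo 0).natAbs + (B.core1Lo 1).natAbs) ≤ r)
    (hclr₁ : (kb : ℤ) < B.B₀lo 0 - B.R' - B.pr)
    {δ ηk : ℝ} (hδ : 0 < δ) (hδ1 : δ ≤ 1) (nB : ℕ)
    -- the inner-chain fact UP TO THE LENGTH BUDGET `nF` (p3-g11 2026-08-22T02:23:54Z; the wrapper discharges it by `ChainFactF` at `n ≤ LfA K₀`)
    (hchain : ∀ (c : V) (Nr N₃ : ℕ), 0 + 1 + Nr + 1 + N₃ ≤ nB → ∀ (W : Sym2 V → unitInterval) (s : Fin (0 + 1 + Nr + 1 + N₃ + 1) → TStep (winGraph G c r))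
      (T' : Fin (0 + 1 + Nr + 1 + N₃ + 1) → Finset V) (η : ℝ),
      (∀ i, (s i).L.o = (s 0).L.o) →
      (∀ i : Fin (0 + 1 + Nr + 1 + N₃), T' (Fin.castSucc i) ⊆ (s i.succ).L.X 0) →
      (∀ i, T' i ⊆ (s i).T) →
      (∀ i, (s i).KitsAtF W q Δ' δ) →
      η ≤ δ / 2 →
      (∀ i, (prodBernoulli W).real (⋃ t ∈ (s i).T \ T' i, openConn (s 0).L.o t) ≤ η) →
      1 - δ < (prodBernoulli W).real (s 0).L.reachB →
        1 - δ₂ ^ 3 < (prodBernoulli W).real (⋃ t ∈ T' (Fin.last (0 + 1 + Nr + 1 + N₃)), openConn (s 0).L.o t))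
    (hcount₁ : 1 / (1 - (q : ℝ)) ^ (Δ' * N₁) ≤ δ * ((Finset.Icc j₀₁ j₁₁).card : ℝ))
    (hcount₂ : 1 / (1 - (q : ℝ)) ^ (Δ' * N₂) ≤ δ * ((Finset.Icc j₀₂ j₁₂).card : ℝ))
    (hcount₃ : 1 / (1 - (q : ℝ)) ^ (Δ' * N₃') ≤ δ * ((Finset.Icc j₀₃ j₁₃).card : ℝ))
    (hηk : ηk ≤ δ / 2)
    (Pb Pr : ApronPrm) {Rs KCmaxb KCmaxr rsb rsr cSb cSr cU r₁ r₂ Rb : ℕ}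
    (hPNb : Mq ≤ Pb.N) (hAb : Pb.A = (Mz : ℤ) + 2)
    (hdDb : Pb.d + 2 ≤ shellD Pb) (hDρb : Rs + 1 ≤ shellD Pb) (hKCmaxb : shellD Pb + Mz + 1 ≤ KCmaxb)
    (hwideb : ∀ j, j₀₁ ≤ j → j ≤ j₁₁ → ∀ i, (B.B₀lo - (j : Site 2)) i + 2 * tanOff Pb.ℓs Pb.M ≤ (B.B₀hi + (j : Site 2)) i)
    (hdwb : ∀ j, j₀₁ ≤ j → j ≤ j₁₁ → ∀ i, (B.B₀lo - (j : Site 2)) i + (Pb.d + 2 : ℕ) ≤ (B.B₀hi + (j : Site 2)) i)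
    (hDwb : ∀ j, j₀₁ ≤ j → j ≤ j₁₁ → ∀ i, (B.B₀lo - (j : Site 2)) i + ((shellD Pb + 1 + Pb.d + Pb.N * KCmaxb + Rs : ℕ) : ℤ) ≤ (B.B₀hi + (j : Site 2)) i)
    (hT'b : (shellD Pb : ℤ) + Pb.N * KCmaxb + Rs ≤ tanOff Pb.ℓs Pb.M)
    (hr₀b : Pb.N * (tanOff Pb.ℓs Pb.M + 2) + Pb.N * Pb.d + (Pb.N * KCmaxb + Rs) ≤ Pb.r₀) (hRb₀ : Pb.r₀ ≤ r)
    (hrsb : 1 + (Pb.N * (tanOff Pb.ℓs Pb.M + 2) + Pb.N * Pb.d + (Pb.N * KCmaxb + Rs)) ≤ rsb)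
    (hcSb : (Pb.N + 1) * (tanOff Pb.ℓs Pb.M + 1) + (Pb.N + 1) * Pb.d + (KCmaxb + 1) * (Pb.N + 2) + cU ≤ cSb)
    (hEb : j₁₁ + (Pb.N * (tanOff Pb.ℓs Pb.M + 1) + Pb.N * Pb.d + Pb.N * KCmaxb) ≤ B.R')
    (hreachb : r₁ + (Pb.N * (tanOff Pb.ℓs Pb.M + 1) + Pb.N * Pb.d + Pb.N * KCmaxb) ≤ Pb.r₀) (hr₁ : Rb ≤ r₁) (hr₁R : r₁ ≤ r)
    (hPNr : Mq * (kq + 3) ≤ Pr.N) (hAr : Pr.A = (Mz + 1 : ℕ) * (shearUnit nL pr.h : ℤ) + 1)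
    (hdDr : Pr.d + 2 ≤ shellD Pr) (hDρr : Rs + 1 ≤ shellD Pr) (hKCmaxr : (shellD Pr + Mz + 1) * (kq + 1) ≤ KCmaxr)
    (hwider : ∀ Nr, ∀ k ≤ Nr, ∀ j, j₀₂ ≤ j → j ≤ j₁₂ → ∀ i, ((xRunSched nL ℓ' pr.h R's qB Nr).lo k - (j : Site 2)) i + 2 * tanOff Pr.ℓs Pr.M ≤
      ((xRunSched nL ℓ' pr.h R's qB Nr).hi k + (j : Site 2)) i)
    (hdwr : ∀ Nr, ∀ k ≤ Nr, ∀ j, j₀₂ ≤ j → j ≤ j₁₂ → ∀ i, ((xRunSched nL ℓ' pr.h R's qB Nr).lo k - (j : Site 2)) i + (Pr.d + 2 : ℕ) ≤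
      ((xRunSched nL ℓ' pr.h R's qB Nr).hi k + (j : Site 2)) i)
    (hDwr : ∀ Nr, ∀ k ≤ Nr, ∀ j, j₀₂ ≤ j → j ≤ j₁₂ → ∀ i, ((xRunSched nL ℓ' pr.h R's qB Nr).lo k - (j : Site 2)) i + ((shellD Pr + 1 + Pr.d + Pr.N * KCmaxr + Rs : ℕ) : ℤ) ≤
      ((xRunSched nL ℓ' pr.h R's qB Nr).hi k + (j : Site 2)) i)
    (hwidey : ∀ N₃, ∀ k ≤ N₃, ∀ j, j₀₃ ≤ j → j ≤ j₁₃ → ∀ i, ((yRunSched hnL hvL hlay R'₃ qB₃ N₃).lo k - (j : Site 2)) i + 2 * tanOff Pr.ℓs Pr.M ≤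
      ((yRunSched hnL hvL hlay R'₃ qB₃ N₃).hi k + (j : Site 2)) i)
    (hdwy : ∀ N₃, ∀ k ≤ N₃, ∀ j, j₀₃ ≤ j → j ≤ j₁₃ → ∀ i, ((yRunSched hnL hvL hlay R'₃ qB₃ N₃).lo k - (j : Site 2)) i + (Pr.d + 2 : ℕ) ≤
      ((yRunSched hnL hvL hlay R'₃ qB₃ N₃).hi k + (j : Site 2)) i)
    (hDwy : ∀ N₃, ∀ k ≤ N₃, ∀ j, j₀₃ ≤ j → j ≤ j₁₃ → ∀ i, ((yRunSched hnL hvL hlay R'₃ qB₃ N₃).lo k - (j : Site 2)) i + ((shellD Pr + 1 + Pr.d + Pr.N * KCmaxr + Rs : ℕ) : ℤ) ≤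
      ((yRunSched hnL hvL hlay R'₃ qB₃ N₃).hi k + (j : Site 2)) i)
    (hwiderY : ∀ Nr, ∀ k ≤ Nr, ∀ j, j₀₂ ≤ j → j ≤ j₁₂ → ∀ i, ((yRunSched hnL hvL hlay R's qB' Nr).lo k - (j : Site 2)) i + 2 * tanOff Pr.ℓs Pr.M ≤
      ((yRunSched hnL hvL hlay R's qB' Nr).hi k + (j : Site 2)) i)
    (hdwrY : ∀ Nr, ∀ k ≤ Nr, ∀ j, j₀₂ ≤ j → j ≤ j₁₂ → ∀ i, ((yRunSched hnL hvL hlay R's qB' Nr).lo k - (j : Site 2)) i + (Pr.d + 2 : ℕ) ≤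
      ((yRunSched hnL hvL hlay R's qB' Nr).hi k + (j : Site 2)) i)
    (hDwrY : ∀ Nr, ∀ k ≤ Nr, ∀ j, j₀₂ ≤ j → j ≤ j₁₂ → ∀ i, ((yRunSched hnL hvL hlay R's qB' Nr).lo k - (j : Site 2)) i + ((shellD Pr + 1 + Pr.d + Pr.N * KCmaxr + Rs : ℕ) : ℤ) ≤
      ((yRunSched hnL hvL hlay R's qB' Nr).hi k + (j : Site 2)) i)
    (hwideyY : ∀ N₃, ∀ k ≤ N₃, ∀ j, j₀₃ ≤ j → j ≤ j₁₃ → ∀ i, ((xRunSched nL ℓ' pr.h R'₃ qB₃' N₃).lo k - (j : Site 2)) i + 2 * tanOff Pr.ℓs Pr.M ≤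
      ((xRunSched nL ℓ' pr.h R'₃ qB₃' N₃).hi k + (j : Site 2)) i)
    (hdwyY : ∀ N₃, ∀ k ≤ N₃, ∀ j, j₀₃ ≤ j → j ≤ j₁₃ → ∀ i, ((xRunSched nL ℓ' pr.h R'₃ qB₃' N₃).lo k - (j : Site 2)) i + (Pr.d + 2 : ℕ) ≤
      ((xRunSched nL ℓ' pr.h R'₃ qB₃' N₃).hi k + (j : Site 2)) i)
    (hDwyY : ∀ N₃, ∀ k ≤ N₃, ∀ j, j₀₃ ≤ j → j ≤ j₁₃ → ∀ i, ((xRunSched nL ℓ' pr.h R'₃ qB₃' N₃).lo k - (j : Site 2)) i + ((shellD Pr + 1 + Pr.d + Pr.N * KCmaxr + Rs : ℕ) : ℤ) ≤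
      ((xRunSched nL ℓ' pr.h R'₃ qB₃' N₃).hi k + (j : Site 2)) i)
    (hT'r : (shellD Pr : ℤ) + Pr.N * KCmaxr + Rs ≤ tanOff Pr.ℓs Pr.M)
    (hr₀r : Pr.N * (tanOff Pr.ℓs Pr.M + 2) + Pr.N * Pr.d + (Pr.N * KCmaxr + Rs) ≤ Pr.r₀) (hRr₀ : Pr.r₀ ≤ r)
    (hrsr : 1 + (Pr.N * (tanOff Pr.ℓs Pr.M + 2) + Pr.N * Pr.d + (Pr.N * KCmaxr + Rs)) ≤ rsr)
    (hcSr : (Pr.N + 1) * (tanOff Pr.ℓs Pr.M + 1) + (Pr.N + 1) * Pr.d + (KCmaxr + 1) * (Pr.N + 2) + cU ≤ cSr)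
    (hEr : j₁₂ + (Pr.N * (tanOff Pr.ℓs Pr.M + 1) + Pr.N * Pr.d + Pr.N * KCmaxr) ≤ R's)
    (hEy : j₁₃ + (Pr.N * (tanOff Pr.ℓs Pr.M + 1) + Pr.N * Pr.d + Pr.N * KCmaxr) ≤ R'₃)
    (hreachr : r₂ + (Pr.N * (tanOff Pr.ℓs Pr.M + 1) + Pr.N * Pr.d + Pr.N * KCmaxr) ≤ Pr.r₀) (hr₂ : Rl ≤ r₂) (hr₂R : r₂ ≤ r)
    -- the short region and the zone datum at the kit centres ((S0): inside `Rg`, connected, containing the centre and the fat-prism box `cylBallFin c kz Rk`)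
    (Rg : V → Finset V) (hRg : ∀ c', ∀ u ∈ Rg c', u ∈ graphBall G c' Rs) (hRgcard : ∀ c', (Rg c').card ≤ cU) (hcU1 : 1 ≤ cU)
    (Λc : V → ℕ → Finset V) (kz : ℕ) (hΛ : ∀ c', ∀ v ∈ Λc c' kz, v ∈ Rg c' ∧ φ v - φ c' ∈ box 2 Mz) (hclrz : (Mz + 4) * (nL + pr.h.natAbs) ≤ nL * (ℓ' + 1))
    (hcz : ∀ c, c ∈ Λc c kz) (hzconn : ∀ c, ∀ s ∈ Λc c kz, PathIn G (↑(Λc c kz) : Set V) c s) (hRsr : Rs ≤ r)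


    {ρZ : ℕ} (hZρ : ∀ c', ∀ s ∈ Λc c' kz, s ∈ graphBall G c' ρZ) (hρr : ρZ ≤ r)
    (hZU : ∀ c, Λc c kz ⊆ pgramPrismFin G φ c nL pr.h (3 * ℓ') Rl)
    (Qb Fb : V → Finset V)
    (hQb : ∀ c c', ∀ w ∈ Qb c', w ∈ graphBall G c' Rb ∧
      rootFrame φ c 1 w ∈ Finset.Icc (rootFrame φ c 1 c' - ((B.pr : ℕ) : Site 2)) (rootFrame φ c 1 c' + ((B.pr : ℕ) : Site 2)))
    (hFb : ∀ c c', ∀ w ∈ Fb c', w ∈ Qb c' ∧ rootFrame φ c 1 w ∈ Finset.Icc (rootFrame φ c 1 c' + B.dlo) (rootFrame φ c 1 c' + B.dhi))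
    (kk₁ kk₂ kk₃ : ℕ) (hkN₁ : kk₁ * (Δg + 1) ^ (2 * rsb) ≤ N₁) (hkN₂ : kk₂ * (Δg + 1) ^ (2 * rsr) ≤ N₂) (hkN₃ : kk₃ * (Δg + 1) ^ (2 * rsr) ≤ N₃')
    (hk₁ : (1 - (q : ℝ) ^ (1 + Δg * cSb + cSb * cU)) ^ kk₁ ≤ δ) (hk₂ : (1 - (q : ℝ) ^ (1 + Δg * cSr + cSr * cU)) ^ kk₂ ≤ δ)
    (hk₃ : (1 - (q : ℝ) ^ (1 + Δg * cSr + cSr * cU)) ^ kk₃ ≤ δ)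
    (hbridge : ∀ c', 1 - δ ^ 3 < (bondPercolation G q).real (linkIn (↑(Qb c') : Set V) (Λc c' kz) (Fb c')))
    (hlongx : ∀ c' (τ : ℤ), τ = 1 ∨ τ = -1 → 1 - δ ^ 3 < (bondPercolation G q).real
      (linkIn (pgramPrism G φ c' nL pr.h (3 * ℓ') Rl) (Λc c' kz) (pgSideHalfW G φ c' nL pr.h ℓ' Rl 1 (1 * τ))))
    (hlongy : ∀ c' (τ : ℤ), τ = 1 ∨ τ = -1 → 1 - δ ^ 3 < (bondPercolation G q).real
      (linkIn (pgramPrism G φ c' nL pr.h (3 * ℓ') Rl) (Λc c' kz) (pgTopPieceW G φ c' nL pr.h ℓ' Rl 1 τ pr.vα)))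
    {R₁k : ℕ}
    (hR₁k : ∀ (c' : V) (R' : ℕ), R₁k ≤ R' → ∀ (Rw : ℕ) (D' B' : Finset V), (∀ d ∈ D', d ∈ graphBall G c' Rw) →
      (∀ d ∈ D', ∀ d' ∈ D', φ d - φ d' ∈ box 2 m) → B' ⊆ D' → (∀ a ∈ B', a ∈ graphBall G c' ρZ) →
        (bondPercolation G q).real (excess G c' R' D' B') ≤ ηk)
    (hR₁b : R₁k ≤ r - Pb.r₀) (hR₁r : R₁k ≤ r - Pr.r₀)
    -- the FACE KIT: constants, exit table rooms, reach, inputs at accuracy `δ₂`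
    (PA : ApronPrm) {nz KCmax rs cS : ℕ} (hPN : 3 * Mq ≤ PA.N) (hA : PA.A = (nz + 1 : ℕ) * pr.D + 1)
    (hdD : PA.d + 2 ≤ shellD PA) (hDρ : Rs + 1 ≤ shellD PA) (hKCmax : (shellD PA + nz + 1) * 3 ≤ KCmax)
    (hMtan : tanOff PA.ℓs PA.M ≤ (M : ℤ) + 1) (hMd : PA.d + 2 ≤ 2 * M + 2) (hMD : shellD PA + 1 + PA.d + PA.N * KCmax + Rs ≤ 2 * M + 2)
    (hT' : (shellD PA : ℤ) + PA.N * KCmax + Rs ≤ tanOff PA.ℓs PA.M)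
    (hr₀ : PA.N * (tanOff PA.ℓs PA.M + 2) + PA.N * PA.d + (PA.N * KCmax + Rs) ≤ PA.r₀) (hr₀L : PA.r₀ + 1 ≤ 2 * L')
    (hrs : 1 + (PA.N * (tanOff PA.ℓs PA.M + 2) + PA.N * PA.d + (PA.N * KCmax + Rs)) ≤ rs)
    (hcS : (PA.N + 1) * (tanOff PA.ℓs PA.M + 1) + (PA.N + 1) * PA.d + (KCmax + 1) * (PA.N + 2) + cU ≤ cS)
    (hE : Rlev + (PA.N * (tanOff PA.ℓs PA.M + 1) + PA.N * PA.d + PA.N * KCmax) ≤ E)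
    (hreach : r + (PA.N * (tanOff PA.ℓs PA.M + 1) + PA.N * PA.d + PA.N * KCmax) ≤ PA.r₀)

    (kk : ℕ) (hN : kk * (Δg + 1) ^ (2 * rs) ≤ N) (hk : (1 - (q : ℝ) ^ (1 + Δg * cS + cS * cU)) ^ kk ≤ δ₂)
    -- THE PER-CENTRE NUMBERS (x-faces `du.1 = 0`, y′-faces `du.1 = 1`)
    (yx : Bool)
    (numsX : ∀ (a' : ℕ) (x : Site 2) (du : MDir) (j : ℕ) (pc : ℤ) (c' : V), du.1 = 0 → du.2 = true → j < P.K → ∀ yF : V,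
      pr.ψ φ w₀ yF = P.faceCen x du j → pc = relφ φ w₀ yF (pr.bOf du.1) →
      pr.frame φ w₀ du.1 (pr.bOf du.1) c' ∈ Finset.Icc (loNV P x du j pc (aw du) - ((E : ℕ) : Site 2)) (hiNV P x du j pc (aw du) + ((E : ℕ) : Site 2)) →
      c' ∈ graphBall G w₀ ((concRadii2N P.toPCells2 gap gap' E₀ L' off).rE a' x du - r) →
      L' ≤ (concRadii2N P.toPCells2 gap gap' E₀ L' off).rM a' (x + stepVec du) → r ≤ (concRadii2N P.toPCells2 gap gap' E₀ L' off).rE a' x du →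
      FaceRunNumsX4 G φ (pr.ψ φ w₀) c' pr.A nL pr.h pr.vα pr.vβ pr.c₀ pr.c₁ pr.D du (sgOf du) B ℓ' R's qB R'₃ qB₃ pr.vα hnL hvL hlay Mz
        (P.farCore x du j k₀) (targetMMV G φ pr P w₀ (concRadii2N P.toPCells2 gap gap' E₀ L' off) b₀ a' x du L') (Λc c' Mz) r (kA du.1) (kA (oth du.1)))
    (numsY : ∀ (a' : ℕ) (x : Site 2) (du : MDir) (j : ℕ) (pc : ℤ) (c' : V), du.1 = 1 → yx = false → du.2 = true → j < P.K → ∀ yF : V,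
      pr.ψ φ w₀ yF = P.faceCen x du j → pc = relφ φ w₀ yF (pr.bOf du.1) →
      pr.frame φ w₀ du.1 (pr.bOf du.1) c' ∈ Finset.Icc (loNV P x du j pc (aw du) - ((E : ℕ) : Site 2)) (hiNV P x du j pc (aw du) + ((E : ℕ) : Site 2)) →
      c' ∈ graphBall G w₀ ((concRadii2N P.toPCells2 gap gap' E₀ L' off).rE a' x du - r) →
      L' ≤ (concRadii2N P.toPCells2 gap gap' E₀ L' off).rM a' (x + stepVec du) → r ≤ (concRadii2N P.toPCells2 gap gap' E₀ L' off).rE a' x du →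
      FaceRunNumsY4 G φ (pr.ψ φ w₀) c' pr.A nL pr.h pr.vα pr.vβ pr.c₀ pr.c₁ pr.D du 1 (sgOf du) B ℓ' R's qB' R'₃ qB₃' pr.vα hnL hvL
        hlay Mz (P.farCore x du j k₀) (targetMMV G φ pr P w₀ (concRadii2N P.toPCells2 gap gap' E₀ L' off) b₀ a' x du L') (Λc c' Mz) r (kA du.1) (kA (oth du.1)))
    (numsYx : ∀ (a' : ℕ) (x : Site 2) (du : MDir) (j : ℕ) (pc : ℤ) (c' : V), du.1 = 1 → yx = true → du.2 = true → j < P.K → ∀ yF : V,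
      pr.ψ φ w₀ yF = P.faceCen x du j → pc = relφ φ w₀ yF (pr.bOf du.1) →
      pr.frame φ w₀ du.1 (pr.bOf du.1) c' ∈ Finset.Icc (loNV P x du j pc (aw du) - ((E : ℕ) : Site 2)) (hiNV P x du j pc (aw du) + ((E : ℕ) : Site 2)) →
      c' ∈ graphBall G w₀ ((concRadii2N P.toPCells2 gap gap' E₀ L' off).rE a' x du - r) →
      L' ≤ (concRadii2N P.toPCells2 gap gap' E₀ L' off).rM a' (x + stepVec du) → r ≤ (concRadii2N P.toPCells2 gap gap' E₀ L' off).rE a' x du →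
      FaceRunNumsX4 G φ (pr.ψ φ w₀) c' pr.A nL pr.h pr.vα pr.vβ pr.c₀ pr.c₁ pr.D du (sgOf du) B ℓ' R's qB R'₃ qB₃ pr.vα hnL hvL hlay Mz
        (P.farCore x du j k₀) (targetMMV G φ pr P w₀ (concRadii2N P.toPCells2 gap gap' E₀ L' off) b₀ a' x du L') (Λc c' Mz) r (kA du.1) (kA (oth du.1)))
    -- the providers' stride counts within the budget
    (hnFx : ∀ (a' : ℕ) (x : Site 2) (du : MDir) (j : ℕ) (pc : ℤ) (c' : V) (hI : du.1 = 0) (hs : du.2 = true) (hj : j < P.K) (yF : V)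
      (hyF : pr.ψ φ w₀ yF = P.faceCen x du j) (hpc : pc = relφ φ w₀ yF (pr.bOf du.1))
      (h1 : pr.frame φ w₀ du.1 (pr.bOf du.1) c' ∈ Finset.Icc (loNV P x du j pc (aw du) - ((E : ℕ) : Site 2)) (hiNV P x du j pc (aw du) + ((E : ℕ) : Site 2)))
      (h2 : c' ∈ graphBall G w₀ ((concRadii2N P.toPCells2 gap gap' E₀ L' off).rE a' x du - r))
      (hM : L' ≤ (concRadii2N P.toPCells2 gap gap' E₀ L' off).rM a' (x + stepVec du)) (hE : r ≤ (concRadii2N P.toPCells2 gap gap' E₀ L' off).rE a' x du),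
      0 + 1 + (numsX a' x du j pc c' hI hs hj yF hyF hpc h1 h2 hM hE).Nr + 1 + (numsX a' x du j pc c' hI hs hj yF hyF hpc h1 h2 hM hE).N₃ ≤ nB)
    (hnFy : ∀ (a' : ℕ) (x : Site 2) (du : MDir) (j : ℕ) (pc : ℤ) (c' : V) (hI : du.1 = 1) (hyx : yx = false) (hs : du.2 = true) (hj : j < P.K) (yF : V)
      (hyF : pr.ψ φ w₀ yF = P.faceCen x du j) (hpc : pc = relφ φ w₀ yF (pr.bOf du.1))
      (h1 : pr.frame φ w₀ du.1 (pr.bOf du.1) c' ∈ Finset.Icc (loNV P x du j pc (aw du) - ((E : ℕ) : Site 2)) (hiNV P x du j pc (aw du) + ((E : ℕ) : Site 2)))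
      (h2 : c' ∈ graphBall G w₀ ((concRadii2N P.toPCells2 gap gap' E₀ L' off).rE a' x du - r))
      (hM : L' ≤ (concRadii2N P.toPCells2 gap gap' E₀ L' off).rM a' (x + stepVec du)) (hE : r ≤ (concRadii2N P.toPCells2 gap gap' E₀ L' off).rE a' x du),
      0 + 1 + (numsY a' x du j pc c' hI hyx hs hj yF hyF hpc h1 h2 hM hE).Nr + 1 + (numsY a' x du j pc c' hI hyx hs hj yF hyF hpc h1 h2 hM hE).N₃ ≤ nB)
    (hnFyx : ∀ (a' : ℕ) (x : Site 2) (du : MDir) (j : ℕ) (pc : ℤ) (c' : V) (hI : du.1 = 1) (hyx : yx = true) (hs : du.2 = true) (hj : j < P.K) (yF : V)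
      (hyF : pr.ψ φ w₀ yF = P.faceCen x du j) (hpc : pc = relφ φ w₀ yF (pr.bOf du.1))
      (h1 : pr.frame φ w₀ du.1 (pr.bOf du.1) c' ∈ Finset.Icc (loNV P x du j pc (aw du) - ((E : ℕ) : Site 2)) (hiNV P x du j pc (aw du) + ((E : ℕ) : Site 2)))
      (h2 : c' ∈ graphBall G w₀ ((concRadii2N P.toPCells2 gap gap' E₀ L' off).rE a' x du - r))
      (hM : L' ≤ (concRadii2N P.toPCells2 gap gap' E₀ L' off).rM a' (x + stepVec du)) (hE : r ≤ (concRadii2N P.toPCells2 gap gap' E₀ L' off).rE a' x du),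
      0 + 1 + (numsYx a' x du j pc c' hI hyx hs hj yF hyF hpc h1 h2 hM hE).Nr + 1 + (numsYx a' x du j pc c' hI hyx hs hj yF hyF hpc h1 h2 hM hE).N₃ ≤ nB)
    -- ONE-SIDED ((R-44)(c)): the numbers' tangential sign is the served sign `1` (one-sided counts `KS.N3WX/N3WY`)
    (hσTx : ∀ (a' : ℕ) (x : Site 2) (du : MDir) (j : ℕ) (pc : ℤ) (c' : V) (hI : du.1 = 0) (hs : du.2 = true) (hj : j < P.K) (yF : V)
      (hyF : pr.ψ φ w₀ yF = P.faceCen x du j) (hpc : pc = relφ φ w₀ yF (pr.bOf du.1))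
      (h1 : pr.frame φ w₀ du.1 (pr.bOf du.1) c' ∈ Finset.Icc (loNV P x du j pc (aw du) - ((E : ℕ) : Site 2)) (hiNV P x du j pc (aw du) + ((E : ℕ) : Site 2)))
      (h2 : c' ∈ graphBall G w₀ ((concRadii2N P.toPCells2 gap gap' E₀ L' off).rE a' x du - r))
      (hM : L' ≤ (concRadii2N P.toPCells2 gap gap' E₀ L' off).rM a' (x + stepVec du)) (hE : r ≤ (concRadii2N P.toPCells2 gap gap' E₀ L' off).rE a' x du),
      (numsX a' x du j pc c' hI hs hj yF hyF hpc h1 h2 hM hE).σT = 1)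
    (hσTy : ∀ (a' : ℕ) (x : Site 2) (du : MDir) (j : ℕ) (pc : ℤ) (c' : V) (hI : du.1 = 1) (hyx : yx = false) (hs : du.2 = true) (hj : j < P.K) (yF : V)
      (hyF : pr.ψ φ w₀ yF = P.faceCen x du j) (hpc : pc = relφ φ w₀ yF (pr.bOf du.1))
      (h1 : pr.frame φ w₀ du.1 (pr.bOf du.1) c' ∈ Finset.Icc (loNV P x du j pc (aw du) - ((E : ℕ) : Site 2)) (hiNV P x du j pc (aw du) + ((E : ℕ) : Site 2)))
      (h2 : c' ∈ graphBall G w₀ ((concRadii2N P.toPCells2 gap gap' E₀ L' off).rE a' x du - r))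
      (hM : L' ≤ (concRadii2N P.toPCells2 gap gap' E₀ L' off).rM a' (x + stepVec du)) (hE : r ≤ (concRadii2N P.toPCells2 gap gap' E₀ L' off).rE a' x du),
      (numsY a' x du j pc c' hI hyx hs hj yF hyF hpc h1 h2 hM hE).σT = 1)
    (hσTyx : ∀ (a' : ℕ) (x : Site 2) (du : MDir) (j : ℕ) (pc : ℤ) (c' : V) (hI : du.1 = 1) (hyx : yx = true) (hs : du.2 = true) (hj : j < P.K) (yF : V)
      (hyF : pr.ψ φ w₀ yF = P.faceCen x du j) (hpc : pc = relφ φ w₀ yF (pr.bOf du.1))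
      (h1 : pr.frame φ w₀ du.1 (pr.bOf du.1) c' ∈ Finset.Icc (loNV P x du j pc (aw du) - ((E : ℕ) : Site 2)) (hiNV P x du j pc (aw du) + ((E : ℕ) : Site 2)))
      (h2 : c' ∈ graphBall G w₀ ((concRadii2N P.toPCells2 gap gap' E₀ L' off).rE a' x du - r))
      (hM : L' ≤ (concRadii2N P.toPCells2 gap gap' E₀ L' off).rM a' (x + stepVec du)) (hE : r ≤ (concRadii2N P.toPCells2 gap gap' E₀ L' off).rE a' x du),
      (numsYx a' x du j pc c' hI hyx hs hj yF hyF hpc h1 h2 hM hE).σT = 1)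
    -- (WAVE-Q, located design item L-stmt-1, option (C); refuter read p5-g28 2026-08-27T09:25:46Z) THE RUN-LENGTH FLOORS AT QUASI-STEP COST `Mq` of the three numbers
    -- binders (lower bounds on the face radius `r` over the providers' `RcL/RcT/Nr/N₃` — at the providers Q16/Q17/Q24 the named choice functions; the records' `Mq`-free fields
    -- `hπ2/hπ3` are not read)
    (hπMx : ∀ (a' : ℕ) (x : Site 2) (du : MDir) (j : ℕ) (pc : ℤ) (c' : V) (hI : du.1 = 0) (hs : du.2 = true) (hj : j < P.K) (yF : V)
      (hyF : pr.ψ φ w₀ yF = P.faceCen x du j) (hpc : pc = relφ φ w₀ yF (pr.bOf du.1))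
      (h1 : pr.frame φ w₀ du.1 (pr.bOf du.1) c' ∈ Finset.Icc (loNV P x du j pc (aw du) - ((E : ℕ) : Site 2)) (hiNV P x du j pc (aw du) + ((E : ℕ) : Site 2)))
      (h2 : c' ∈ graphBall G w₀ ((concRadii2N P.toPCells2 gap gap' E₀ L' off).rE a' x du - r))
      (hM : L' ≤ (concRadii2N P.toPCells2 gap gap' E₀ L' off).rM a' (x + stepVec du)) (hE : r ≤ (concRadii2N P.toPCells2 gap gap' E₀ L' off).rE a' x du),
      (numsX a' x du j pc c' hI hs hj yF hyF hpc h1 h2 hM hE).RcL + Mq * (((numsX a' x du j pc c' hI hs hj yF hyF hpc h1 h2 hM hE).Nr + 1) * shearUnit nL pr.h) ≤ r ∧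
      ∀ k ≤ (numsX a' x du j pc c' hI hs hj yF hyF hpc h1 h2 hM hE).N₃, (numsX a' x du j pc c' hI hs hj yF hyF hpc h1 h2 hM hE).RcT + Mq * (((((k + 1 : ℕ) : ℤ) * pr.vα).natAbs +
        (((shearUnit nL pr.h : ℤ) * |((k + 1 : ℕ) : ℤ) * (yPrmW nL ℓ' pr.h pr.vα R'₃ qB₃ (numsX a' x du j pc c' hI hs hj yF hyF hpc h1 h2 hM hE).N₃).sLo| + |pr.h| * |((k + 1 : ℕ) : ℤ) * pr.vα| +
          shearUnit nL pr.h) / nL).natAbs + 1)) ≤ r)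
    (hπMy : ∀ (a' : ℕ) (x : Site 2) (du : MDir) (j : ℕ) (pc : ℤ) (c' : V) (hI : du.1 = 1) (hyx : yx = false) (hs : du.2 = true) (hj : j < P.K) (yF : V)
      (hyF : pr.ψ φ w₀ yF = P.faceCen x du j) (hpc : pc = relφ φ w₀ yF (pr.bOf du.1))
      (h1 : pr.frame φ w₀ du.1 (pr.bOf du.1) c' ∈ Finset.Icc (loNV P x du j pc (aw du) - ((E : ℕ) : Site 2)) (hiNV P x du j pc (aw du) + ((E : ℕ) : Site 2)))
      (h2 : c' ∈ graphBall G w₀ ((concRadii2N P.toPCells2 gap gap' E₀ L' off).rE a' x du - r))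
      (hM : L' ≤ (concRadii2N P.toPCells2 gap gap' E₀ L' off).rM a' (x + stepVec du)) (hE : r ≤ (concRadii2N P.toPCells2 gap gap' E₀ L' off).rE a' x du),
      (∀ k ≤ (numsY a' x du j pc c' hI hyx hs hj yF hyF hpc h1 h2 hM hE).Nr, (numsY a' x du j pc c' hI hyx hs hj yF hyF hpc h1 h2 hM hE).RcL + Mq * (((((k + 1 : ℕ) : ℤ) * pr.vα).natAbs +
        (((shearUnit nL pr.h : ℤ) * |((k + 1 : ℕ) : ℤ) * (yPrmW nL ℓ' pr.h pr.vα R's qB' (numsY a' x du j pc c' hI hyx hs hj yF hyF hpc h1 h2 hM hE).Nr).sLo| + |pr.h| * |((k + 1 : ℕ) : ℤ) * pr.vα| +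
          shearUnit nL pr.h) / nL).natAbs + 1)) ≤ r) ∧
      (numsY a' x du j pc c' hI hyx hs hj yF hyF hpc h1 h2 hM hE).RcT + Mq * (((numsY a' x du j pc c' hI hyx hs hj yF hyF hpc h1 h2 hM hE).N₃ + 1) * shearUnit nL pr.h) ≤ r)
    (hπMyx : ∀ (a' : ℕ) (x : Site 2) (du : MDir) (j : ℕ) (pc : ℤ) (c' : V) (hI : du.1 = 1) (hyx : yx = true) (hs : du.2 = true) (hj : j < P.K) (yF : V)
      (hyF : pr.ψ φ w₀ yF = P.faceCen x du j) (hpc : pc = relφ φ w₀ yF (pr.bOf du.1))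
      (h1 : pr.frame φ w₀ du.1 (pr.bOf du.1) c' ∈ Finset.Icc (loNV P x du j pc (aw du) - ((E : ℕ) : Site 2)) (hiNV P x du j pc (aw du) + ((E : ℕ) : Site 2)))
      (h2 : c' ∈ graphBall G w₀ ((concRadii2N P.toPCells2 gap gap' E₀ L' off).rE a' x du - r))
      (hM : L' ≤ (concRadii2N P.toPCells2 gap gap' E₀ L' off).rM a' (x + stepVec du)) (hE : r ≤ (concRadii2N P.toPCells2 gap gap' E₀ L' off).rE a' x du),
      (numsYx a' x du j pc c' hI hyx hs hj yF hyF hpc h1 h2 hM hE).RcL + Mq * (((numsYx a' x du j pc c' hI hyx hs hj yF hyF hpc h1 h2 hM hE).Nr + 1) * shearUnit nL pr.h) ≤ r ∧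
      ∀ k ≤ (numsYx a' x du j pc c' hI hyx hs hj yF hyF hpc h1 h2 hM hE).N₃, (numsYx a' x du j pc c' hI hyx hs hj yF hyF hpc h1 h2 hM hE).RcT + Mq * (((((k + 1 : ℕ) : ℤ) * pr.vα).natAbs +
        (((shearUnit nL pr.h : ℤ) * |((k + 1 : ℕ) : ℤ) * (yPrmW nL ℓ' pr.h pr.vα R'₃ qB₃ (numsYx a' x du j pc c' hI hyx hs hj yF hyF hpc h1 h2 hM hE).N₃).sLo| + |pr.h| * |((k + 1 : ℕ) : ℤ) * pr.vα| +
          shearUnit nL pr.h) / nL).natAbs + 1)) ≤ r) :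
    FaceOblRMOF G (⟨cellGeomSG₂bV G (pr.ψ φ w₀) P w₀ (concRadii2N P.toPCells2 gap gap' E₀ L' off) b₀, q, δc⟩ : KSchA V ℕ)
      (faceDataSGV G (pr.ψ φ w₀) P w₀ (concRadii2N P.toPCells2 gap gap' E₀ L' off)) Δ' δ₂ :=
  faceOblRM_fineNb2VQ (pr := pr) (φ := φ) (P := P) (w₀ := w₀) (gap := gap) (gap' := gap') (E₀ := E₀) (L' := L') (off := off)
    (b₀ := b₀) (q := q) (δc := δc) hlip hqφ hb₀ hb1 hc₀ hc₁ hDd hD hL0 hL1 hgap hgap20 hgapc hE₀ hL' hoff hoffN hRlev hRlev' hk₀ hk₀' hroomF hkF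
    haw hcount hη R₁ hR₁ hdiam hgapR
    (hkits_faceSteps_of_nums9VCQ hlip hqφ hΔg pr w₀ P gap gap' E₀ L' off b₀ q δc hb₀ hc₀ hc₁ hDd hD hL0 hL1 hA0 hnL hvL hmf hgap hE₀ hL'
      hgapR aw Rlev N M hk₀ hk₀' hRlev hRlev' hroomF hkF hnC hU3 hδ₂ B hB hκL ℓ' R's qB Rl R'₃ qB₃ qB' qB₃' hlay Rlev₁ N₁ j₀₁ j₁₁ Rlev₂ N₂ j₀₂ j₁₂
      Rlev₃ N₃' j₀₃ j₁₃ hRl₁ hRl₂ hRl₃ hj₁ hj₂ hj₃ hB0 hRlr hΛR hΛQ0 hΛQ1 hΛZ hkA0 hkA1 hkbMz hπ1 hclr₁ hδ hδ1 nB hchain hcount₁ hcount₂ hcount₃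
      hηk Pb Pr hPNb hAb hdDb hDρb hKCmaxb hwideb hdwb hDwb hT'b hr₀b hRb₀ hrsb hcSb hEb hreachb hr₁ hr₁R hPNr
      hAr hdDr hDρr hKCmaxr hwider hdwr hDwr hwidey hdwy hDwy hwiderY hdwrY hDwrY hwideyY hdwyY hDwyY hT'r
      hr₀r hRr₀ hrsr hcSr hEr hEy hreachr hr₂ hr₂R Rg hRg hRgcard hcU1 Λc kz hΛ hclrz hcz hzconn hRsr hZρ hρr hZU Qb Fb
      hQb hFb kk₁ kk₂ kk₃ hkN₁ hkN₂ hkN₃ hk₁ hk₂ hk₃ hbridge hlongx hlongy hdiam hR₁k hR₁b hR₁r PA hPN hA hdD hDρ hKCmax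
      hMtan hMd hMD hT' hr₀ hr₀L hrs hcS hE hreach kk hN hk yx numsX numsY numsYx
      hnFx hnFy hnFyx hσTx hσTy hσTyx hπMx hπMy hπMyx)

end Skelφ

end Summit.CriticalPhenomena.PercolationContinuityZ3.Theorems.Transplant

end
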